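import Summits.HodgeConjecture.HodgeConjecture.Theorems.HCCMUnconditionalH413OfFacts   -- ★ `Summit.HodgeConjecture.CorCM.Hyp413Closing.H413_of_three_facts_flat (hdictE) (hJ3a) (hocc) : …Theses.HCCMUnconditional.H413` (E-III2♭ head; hD3 ∕ hD1″ discharged inside)
import Summits.HodgeConjecture.HodgeConjecture.Theorems.F0FloorSockets                -- ★ the FLOOR-0 socket TYPES `HdictEType` ∕ `HJ3aType` ∕ `HoccType` (Theses-free, director s386)
import Summits.HodgeConjecture.HodgeConjecture.Theorems.HCCMUnconditionalF0HoccOfP4    -- `HCCMUnconditionalF0HoccOfP4.F0Hocc_holds : …Theses.HCCMUnconditional.F0Hocc` (socket 27457 CLOSED; A-p17 (g14) text v2 abff5271 ∕ fuse F0P4-p07 (g4))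
import Summits.HodgeConjecture.HodgeConjecture.Theses.HCCMUnconditional               -- route file rev 1 (R2, 7a24856f3f6c): `H413` (item 24833), `F0HdictE` (27455), `F0HJ3a` (27456), `F0Hocc` (27457)
import HarnessLib

/-!
# THE CLOSER OF ITEM stmt-HodgeConjecture-24833 `H413` FROM THE FLOOR-0 SOCKETS — STAGED TEXT v0 (F0P4-p07 (g4), F0P4-plan (g5) 2026-08-31T07:10:11Z (F1))

FILED 2026-08-31 (director s504 (F2), F0P4-plan (g6) 08:01:38Z) by F0P4-p07 (g5) as a `--supports stmt-HodgeConjecture-24833` HELPER: the staged text v0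
(3a4e057b355af565) with this paragraph added, declarations and statements verbatim; the DAY-X theorem `H413_holds` (below, «not in v0») is APPENDED to this
file (append-only) the day sockets 27455 ∕ 27456 close.

Summit `HodgeConjecture`, sub-problem `HodgeConjecture`, route `HCCMUnconditional`, crux item stmt-HodgeConjecture-24833 (`H413`:
[Liu2021, Prop. 4.13] AS PRINTED at the tree's uniform Ω-representation datum).  Cell `hodgecm-mathlib`, programme HC_CM FLOOR 0 (D-0183).
HONEST LABEL: HC_CM is proved only modulo the 7 printed citations until rung 0 closes; THIS file adds no mathematics — it is the 3-socket
composition of the ★ E-III2♭ head.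

WHAT IT IS.  The registry of 24833 (`Cruxes/H413/Lines/a3_liu413.lean` v10.2, A-plan1 (g17) 2026-08-30) rests on EXACTLY three fact-level stubs, the ∀-face
closures of the printed rows III-2 (a)′ `hdictE`, III-J3a `hJ3a`, III-2 (c)′ `hocc` — token-identical to the FLOOR-0 socket types ★
`Theorems.F0FloorSockets.{HdictEType, HJ3aType, HoccType}` = the route's support items `F0HdictE` (stmt-…-27455, programme P2), `F0HJ3a` (27456, P3),
`F0Hocc` (27457, P4).  The ★ Theorems head `Hyp413Closing.H413_of_three_facts_flat` (★ `Theorems/HCCMUnconditionalH413OfFacts.lean` :267, A-p07 ∕ A-plan2;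
`hD3 := HD3_proof`, `hD1pp := HD1pp_proof` inside) takes exactly these three binders and concludes the crux decl BY NAME.  So:

* `H413_of_F0_sockets (h₁ : HdictEType) (h₂ : HJ3aType) (h₃ : HoccType) : …Theses.HCCMUnconditional.H413` — the head re-typed on the socket names
  (the socket `def`s unfold by `delta`, the route `def`s `F0HdictE` ∕ `F0HJ3a` ∕ `F0Hocc` by unification; zero mathematics);
* `H413_of_F0HdictE_F0HJ3a (h₁ : …Theses.HCCMUnconditional.F0HdictE) (h₂ : …F0HJ3a) : …H413` — the same with socket 27457 DISCHARGED by ★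
  `HCCMUnconditionalF0HoccOfP4.F0Hocc_holds` (P4: [Liu2021, Prop. 4.13 «conversely»; Li1992 Thm 2.1; Weil1965 Thm. 5] — admissible weight-one oscillator
  triples occur in `H¹`, via the Rallis inner product formula at rank one and the Siegel–Weil identity for the CM doubled pair);
* DAY-X (not in v0): `theorem H413_holds : …Theses.HCCMUnconditional.H413 := H413_of_F0HdictE_F0HJ3a F0HdictE_holds F0HJ3a_holds` the day the P2 closer of 27455
  (`Cruxes/H413/Lines/F0_P2CohFinComponentIsThetaC.lean`: `stub_PK_localThetaClasses`, `stub_E3flat_automorphicParity`) and the P3 closer of 27456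
  (`Cruxes/H413/Lines/F0_U3LettersRung1.lean` ED. 3: `stub_E1`, `stub_S2`, `stub_R` = [Rogawski1990, Thm. 14.6.4] via ENGINE T1, rung 4) are ★ — then filed
  `--kind proof --workitem stmt-HodgeConjecture-24833` and released `--by …HCCMUnconditionalH413OfF0.H413_holds`.

No `def`, no `sorry`, no `Lines` import; axioms of both theorems = the Lean trio (by-paste cert over the 27457 chain, F0P4-p07 (g4) 2026-08-31).

## References
[Liu2021] Y. Liu, Prop. 4.13 and its proof (FJcycle.tex l. 2110–2146) · [GelbartRogawski1991] Thm 5.1.1 · [Rogawski1990] Thm. 13.3.1, 14.6.4 ·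
[Li1992] Thm 2.1 · [Weil1965] Thm. 5 (p. 76).
-/

set_option autoImplicit false
-- the mandated namespace has the single-problem summit's repeated segment (`HodgeConjecture.HodgeConjecture`)
set_option linter.dupNamespace false

namespace Summit.HodgeConjecture.HodgeConjecture.Theorems.HCCMUnconditionalH413OfF0

open Summit.HodgeConjecture.HodgeConjecture.Theorems (F0FloorSockets.HdictEType F0FloorSockets.HJ3aType F0FloorSockets.HoccType)

set_option synthInstance.maxHeartbeats 400000 in
set_option maxHeartbeats 8000000 in
/-- **`H413` from the three FLOOR-0 sockets, by socket NAME** — ★ `Hyp413Closing.H413_of_three_facts_flat` with its binders spelled as the Theses-free socket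
types `F0FloorSockets.HdictEType` (III-2 (a)′, P2), `HJ3aType` (III-J3a, P3), `HoccType` (III-2 (c)′, P4); the `def`s unfold definitionally.
[cite: Liu2021, Prop. 4.13 (FJcycle.tex l. 2110–2146), proof l. 2145] [cite: GelbartRogawski1991, Thm 5.1.1] -/
theorem H413_of_F0_sockets (h₁ : F0FloorSockets.HdictEType) (h₂ : F0FloorSockets.HJ3aType) (h₃ : F0FloorSockets.HoccType) :
    Summit.HodgeConjecture.HodgeConjecture.Theses.HCCMUnconditional.H413 :=
  Summit.HodgeConjecture.CorCM.Hyp413Closing.H413_of_three_facts_flat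
    (by delta Summit.HodgeConjecture.HodgeConjecture.Theorems.F0FloorSockets.HdictEType at h₁; exact h₁)
    (by delta Summit.HodgeConjecture.HodgeConjecture.Theorems.F0FloorSockets.HJ3aType at h₂; exact h₂)
    (by delta Summit.HodgeConjecture.HodgeConjecture.Theorems.F0FloorSockets.HoccType at h₃; exact h₃)

set_option synthInstance.maxHeartbeats 400000 in
set_option maxHeartbeats 8000000 in
/-- **`H413` modulo the two remaining sockets `F0HdictE` (stmt-…-27455, P2) and `F0HJ3a` (stmt-…-27456, P3)** — socket `F0Hocc` (stmt-…-27457, P4) is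
DISCHARGED by ★ `HCCMUnconditionalF0HoccOfP4.F0Hocc_holds` (Rallis inner product formula at rank one + Siegel–Weil for the CM doubled pair).  The day both
remaining socket closers are ★, `H413_holds := H413_of_F0HdictE_F0HJ3a F0HdictE_holds F0HJ3a_holds` closes item 24833.
[cite: Liu2021, Prop. 4.13, proof l. 2145] [cite: Li1992, Thm 2.1 (26) p. 184] [cite: Weil1965, Thm. 5 (p. 76)] [cite: Rogawski1990, Thm. 13.3.1] -/
theorem H413_of_F0HdictE_F0HJ3a
    (h₁ : Summit.HodgeConjecture.HodgeConjecture.Theses.HCCMUnconditional.F0HdictE)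
    (h₂ : Summit.HodgeConjecture.HodgeConjecture.Theses.HCCMUnconditional.F0HJ3a) :
    Summit.HodgeConjecture.HodgeConjecture.Theses.HCCMUnconditional.H413 :=
  H413_of_F0_sockets h₁ h₂ HCCMUnconditionalF0HoccOfP4.F0Hocc_holds

end Summit.HodgeConjecture.HodgeConjecture.Theorems.HCCMUnconditionalH413OfF0
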